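import Summits.Ventures.PercRepro.S1FiveCircuitsSolidSevenSharp
import Summits.Ventures.PercRepro.S1CoreCapSpreadChainRows

/-!
# PercRepro — THE SPREAD `s₄` AND `s₅` CAPS AT NULLITY `7` (NO POINT COUNT) AND AT NULLITY `8` (EVERY POINT COUNT) (p1, gen 35)

`proofs/P1-S2-CORANK6.md` §4p. FIVE-CIRCUITS: the per-point table `C(j + 3, 4)` at `j ≤ 3`, `17 / 28 / 44 / 66` at `4 / 5 / 6 / 7` (the
landed nullity-`4`, `5`, `6` caps and `ncard_fiveCircuitsThrough_le_sixty_six_of_nullity_seven`) sums to `176`, so every spread e-free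
core of nullity `7` has `s₅ ≤ 176` (`ncard_fiveCircuits_le_one_seventy_six_of_nullity_seven`), and the averaging recursion gives
**`s₅ ≤ ⌊n·176/(n − 5)⌋`** on the coloop-free spread e-free core of nullity `8` on `n > 5` points
(`ncard_fiveCircuits_le_mul_div_nullity_eight`; `231` at `n = 21`, the `(13, 8)` cell: `ncard_fiveCircuits_le_two_thirty_one_thirteen_eight`).
FOUR-CIRCUITS: the spread per-point table `qSpread` at `j ≤ 6` (`0, 1, 4, 5, 6, 8, 9`) extended by the PLAIN value `19` at `j = 7`
(`Seven.fourCapSpec_seven`, the plain spec implying the spread spec) sums to `52`: `s₄ ≤ 52` on every spread e-free core of nullity `7`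
(`ncard_fourCircuits_le_fifty_two_spread`), hence **`s₄ ≤ ⌊n·52/(n − 4)⌋`** on the coloop-free one of nullity `8`
(`ncard_fourCircuits_le_mul_div_spread_eight`; `64` at `n = 21`: `ncard_fourCircuits_le_sixty_four_spread_twenty_one`).
Nothing about any cell is claimed. Axioms: standard.
-/

open scoped Matroid

namespace PercRepro

namespace S1

open Set

open FourCap

variable {α : Type}

/-! ### Five-circuits -/

/-- **The per-point table with four parameters**: `C(j + 3, 4)` at `j ≤ 3`, `q₄, q₅, q₆, q₇` at `4 … 7`, `C(j + 3, 4)` beyond. -/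
def qFiveSeven (q₄ q₅ q₆ q₇ : ℕ) (j : ℕ) : ℕ :=
  if j = 4 then q₄ else if j = 5 then q₅ else if j = 6 then q₆ else if j = 7 then q₇ else (j + 3).choose 4

/-- `Σ_{j ≤ 7} qFiveSeven q₄ q₅ q₆ q₇ j = 21 + q₄ + q₅ + q₆ + q₇`. -/
theorem capSum_qFiveSeven_seven (q₄ q₅ q₆ q₇ : ℕ) : capSum (qFiveSeven q₄ q₅ q₆ q₇) 7 = 21 + q₄ + q₅ + q₆ + q₇ := by
  simp only [capSum, qFiveSeven, Finset.sum_range_succ, Finset.sum_range_zero]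
  norm_num [Nat.choose]

/-- **`s₅ ≤ 21 + q₄ + q₅ + q₆ + q₇` on every spread e-free core of nullity `7`** modulo the per-point bounds at nullities `4 … 7`. -/
theorem ncard_fiveCircuits_le_of_perPoint_four_to_seven (M : Matroid α) [M.Finite]
    (hfree : ∀ e ∈ M.E, ∃ A ⊆ M.E \ {e}, e ∉ M.closure A ∧ e ∉ M.closure ((M.E \ {e}) \ A))
    (hns : ¬ ∃ W ⊆ M.E, W.ncard ≤ 9 ∧ W.encard = M.eRk W + 4) (hd : M.E.encard = M.eRank + 7) (q₄ q₅ q₆ q₇ : ℕ)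
    (h4 : ∀ (M' : Matroid α) [M'.Finite],
      (∀ e ∈ M'.E, ∃ A ⊆ M'.E \ {e}, e ∉ M'.closure A ∧ e ∉ M'.closure ((M'.E \ {e}) \ A)) →
      (¬ ∃ W ⊆ M'.E, W.ncard ≤ 9 ∧ W.encard = M'.eRk W + 4) → M'.E.encard = M'.eRank + 4 → ∀ e ∈ M'.E,
      {C : Set α | M'.IsCircuit C ∧ C.ncard = 5 ∧ e ∈ C}.ncard ≤ q₄)
    (h5 : ∀ (M' : Matroid α) [M'.Finite],
      (∀ e ∈ M'.E, ∃ A ⊆ M'.E \ {e}, e ∉ M'.closure A ∧ e ∉ M'.closure ((M'.E \ {e}) \ A)) →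
      (¬ ∃ W ⊆ M'.E, W.ncard ≤ 9 ∧ W.encard = M'.eRk W + 4) → M'.E.encard = M'.eRank + 5 → ∀ e ∈ M'.E,
      {C : Set α | M'.IsCircuit C ∧ C.ncard = 5 ∧ e ∈ C}.ncard ≤ q₅)
    (h6 : ∀ (M' : Matroid α) [M'.Finite],
      (∀ e ∈ M'.E, ∃ A ⊆ M'.E \ {e}, e ∉ M'.closure A ∧ e ∉ M'.closure ((M'.E \ {e}) \ A)) →
      (¬ ∃ W ⊆ M'.E, W.ncard ≤ 9 ∧ W.encard = M'.eRk W + 4) → M'.E.encard = M'.eRank + 6 → ∀ e ∈ M'.E,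
      {C : Set α | M'.IsCircuit C ∧ C.ncard = 5 ∧ e ∈ C}.ncard ≤ q₆)
    (h7 : ∀ (M' : Matroid α) [M'.Finite],
      (∀ e ∈ M'.E, ∃ A ⊆ M'.E \ {e}, e ∉ M'.closure A ∧ e ∉ M'.closure ((M'.E \ {e}) \ A)) →
      (¬ ∃ W ⊆ M'.E, W.ncard ≤ 9 ∧ W.encard = M'.eRk W + 4) → M'.E.encard = M'.eRank + 7 → ∀ e ∈ M'.E,
      {C : Set α | M'.IsCircuit C ∧ C.ncard = 5 ∧ e ∈ C}.ncard ≤ q₇) :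
    {C : Set α | M.IsCircuit C ∧ C.ncard = 5}.ncard ≤ 21 + q₄ + q₅ + q₆ + q₇ := by
  have h := ncard_fiveCircuits_le_capSum_spread_of M hfree hns (d := 7) (by exact_mod_cast hd) (qFiveSeven q₄ q₅ q₆ q₇) (by
    intro M' _ hfree' hns' j hj e he
    by_cases h4' : j = 4
    · subst h4'
      simp only [qFiveSeven, if_true]
      exact h4 M' hfree' hns' hj e he
    by_cases h5' : j = 5
    · subst h5'
      simp only [qFiveSeven, h4', if_false, if_true]
      exact h5 M' hfree' hns' hj e he
    by_cases h6' : j = 6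
    · subst h6'
      simp only [qFiveSeven, h4', h5', if_false, if_true]
      exact h6 M' hfree' hns' hj e he
    by_cases h7' : j = 7
    · subst h7'
      simp only [qFiveSeven, h4', h5', h6', if_false, if_true]
      exact h7 M' hfree' hns' hj e he
    simp only [qFiveSeven, h4', h5', h6', h7', if_false]
    exact ncard_fiveCircuitsThrough_le_choose M' hj e)
  rwa [capSum_qFiveSeven_seven] at h

/-- **`s₅ ≤ 176` on every spread e-free core of nullity `7`** (`21 + 17 + 28 + 44 + 66`). -/
theorem ncard_fiveCircuits_le_one_seventy_six_of_nullity_seven (M : Matroid α) [M.Finite]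
    (hfree : ∀ e ∈ M.E, ∃ A ⊆ M.E \ {e}, e ∉ M.closure A ∧ e ∉ M.closure ((M.E \ {e}) \ A))
    (hns : ¬ ∃ W ⊆ M.E, W.ncard ≤ 9 ∧ W.encard = M.eRk W + 4) (hd : M.E.encard = M.eRank + 7) :
    {C : Set α | M.IsCircuit C ∧ C.ncard = 5}.ncard ≤ 176 := by
  have h := ncard_fiveCircuits_le_of_perPoint_four_to_seven M hfree hns hd 17 28 44 66
    (fun M' _ hfree' hns' hd' e _ => ncard_fiveCircuitsThrough_le_seventeen_of_nullity_four M' hfree' hns' hd' e)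
    (fun M' _ hfree' hns' hd' e _ => ncard_fiveCircuitsThrough_le_twenty_eight_of_nullity_five M' hfree' hns' hd' e)
    (fun M' _ hfree' hns' hd' e _ => ncard_fiveCircuitsThrough_le_forty_four_of_nullity_six M' hfree' hns' hd' e)
    (fun M' _ hfree' hns' hd' e _ => ncard_fiveCircuitsThrough_le_sixty_six_of_nullity_seven M' hfree' hns' hd' e)
  simpa using h

/-- **The nullity-`8` spread `s₅` cap for ANY point count, unconditionally**: on a coloop-free spread e-free core of nullity `8` on
`n > 5` points, `s₅ ≤ ⌊n·176/(n − 5)⌋` (`231` at `n = 21`, `236` at `20`, `241` at `19`). -/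
theorem ncard_fiveCircuits_le_mul_div_nullity_eight (M : Matroid α) [M.Finite]
    (hfree : ∀ e ∈ M.E, ∃ A ⊆ M.E \ {e}, e ∉ M.closure A ∧ e ∉ M.closure ((M.E \ {e}) \ A))
    (hns : ¬ ∃ W ⊆ M.E, W.ncard ≤ 9 ∧ W.encard = M.eRk W + 4) (hd : M.E.encard = M.eRank + 8)
    {n : ℕ} (hn : M.E.ncard = n) (hn5 : 5 < n) (hK : ∀ e, ¬ M.IsColoop e) :
    {C : Set α | M.IsCircuit C ∧ C.ncard = 5}.ncard ≤ n * 176 / (n - 5) :=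
  ncard_fiveCircuits_le_mul_div_spread_of M hfree hns (d := 7) (by rw [hd]; norm_num) hn hn5 hK
    (B := 176) (fun M' _ hfree' hns' hd' => ncard_fiveCircuits_le_one_seventy_six_of_nullity_seven M' hfree' hns' hd')

/-- **THE `(13, 8)` SPREAD `s₅` CAP: `s₅ ≤ 231`** on the coloop-free spread e-free core of rank `13` on `21` points
(`⌊21·176/16⌋ = 231`). -/
theorem ncard_fiveCircuits_le_two_thirty_one_thirteen_eight (M : Matroid α) [M.Finite]
    (hfree : ∀ e ∈ M.E, ∃ A ⊆ M.E \ {e}, e ∉ M.closure A ∧ e ∉ M.closure ((M.E \ {e}) \ A))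
    (hns : ¬ ∃ W ⊆ M.E, W.ncard ≤ 9 ∧ W.encard = M.eRk W + 4) (hd : M.E.encard = M.eRank + 8)
    (hn : M.E.ncard = 21) (hK : ∀ e, ¬ M.IsColoop e) :
    {C : Set α | M.IsCircuit C ∧ C.ncard = 5}.ncard ≤ 231 := by
  have h := ncard_fiveCircuits_le_mul_div_nullity_eight M hfree hns hd hn (by norm_num) hK
  norm_num at h
  exact h

/-! ### Four-circuits -/

/-- **The spread per-point table with the plain value `19` at nullity `7`**: `qSpread` at `j ≠ 7`, `19` at `j = 7`. -/
def qSpreadSeven (j : ℕ) : ℕ := if j = 7 then 19 else qSpread j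

/-- `Σ_{j ≤ 7} qSpreadSeven j = 52`. -/
theorem capSum_qSpreadSeven_seven : capSum qSpreadSeven 7 = 52 := by decide

/-- **The spread spec instances `j ≤ 7`**: the landed spread instances at `j ≤ 6` and the plain instance `Q*(7) = 19` at `j = 7`. -/
theorem fourCapSpecSpread_qSpreadSeven : ∀ j ≤ 7, FourCapSpecSpread capPaper j (qSpreadSeven j) := by
  intro j hj
  by_cases hj6 : j ≤ 6
  · have hne : j ≠ 7 := by omega
    simp only [qSpreadSeven, hne, if_false]
    exact fourCapSpecSpread_qSpread j hj6
  · have : j = 7 := by omega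
    subst this
    simp only [qSpreadSeven, if_true]
    exact FourCapSpecSpread.of_fourCapSpec Seven.fourCapSpec_seven

/-- **`s₄ ≤ 52` on every spread e-free core of nullity `7`** (`33 + 19`). -/
theorem ncard_fourCircuits_le_fifty_two_spread (M : Matroid α) [M.Finite]
    (hfree : ∀ e ∈ M.E, ∃ A ⊆ M.E \ {e}, e ∉ M.closure A ∧ e ∉ M.closure ((M.E \ {e}) \ A))
    (hns : ¬ ∃ W ⊆ M.E, W.ncard ≤ 9 ∧ W.encard = M.eRk W + 4) (hd : M.E.encard = M.eRank + 7) :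
    {C : Set α | M.IsCircuit C ∧ C.ncard = 4}.ncard ≤ 52 := by
  have := ncard_fourCircuits_le_capSum_spread_of M hfree hns (d := 7) (by exact_mod_cast hd) qSpreadSeven
    fourCapSpecSpread_qSpreadSeven
  rwa [capSum_qSpreadSeven_seven] at this

/-- **The spread `s₄` cap at nullity `8` on `n` points, coloop-free**: `s₄ ≤ ⌊n·52/(n − 4)⌋` (`s − ⌊4s/n⌋ ≤ 52`). -/
theorem ncard_fourCircuits_le_mul_div_spread_eight (M : Matroid α) [M.Finite]
    (hfree : ∀ e ∈ M.E, ∃ A ⊆ M.E \ {e}, e ∉ M.closure A ∧ e ∉ M.closure ((M.E \ {e}) \ A))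
    (hns : ¬ ∃ W ⊆ M.E, W.ncard ≤ 9 ∧ W.encard = M.eRk W + 4) (hd : M.E.encard = M.eRank + 8)
    {n : ℕ} (hn : M.E.ncard = n) (hn4 : 4 < n) (hK : ∀ e, ¬ M.IsColoop e) :
    {C : Set α | M.IsCircuit C ∧ C.ncard = 4}.ncard ≤ n * 52 / (n - 4) := by
  have hcol : M.coloops = ∅ := S2.coloops_eq_empty_of_forall_not M hK
  have hm : n ≤ (M.E \ M.coloops).ncard := by rw [hcol, Set.sdiff_empty, hn]
  have h := ncard_fourCircuits_sub_div_le_of_nonColoops_spread M hfree hns (d := 7) (by rw [hd]; norm_num) (by omega) hm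
    (B := 52) (fun M' _ hfree' hns' hd'' => ncard_fourCircuits_le_fifty_two_spread M' hfree' hns' (by rw [hd'']; norm_num))
  exact le_mul_div_of_sub_div_le hn4 h

/-- **THE `(13, 8)` SPREAD `s₄` CAP: `s₄ ≤ 64`** on the coloop-free spread e-free core of nullity `8` on `21` points
(`⌊21·52/17⌋ = 64`). -/
theorem ncard_fourCircuits_le_sixty_four_spread_twenty_one (M : Matroid α) [M.Finite]
    (hfree : ∀ e ∈ M.E, ∃ A ⊆ M.E \ {e}, e ∉ M.closure A ∧ e ∉ M.closure ((M.E \ {e}) \ A))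
    (hns : ¬ ∃ W ⊆ M.E, W.ncard ≤ 9 ∧ W.encard = M.eRk W + 4) (hd : M.E.encard = M.eRank + 8)
    (hn : M.E.ncard = 21) (hK : ∀ e, ¬ M.IsColoop e) :
    {C : Set α | M.IsCircuit C ∧ C.ncard = 4}.ncard ≤ 64 := by
  have h := ncard_fourCircuits_le_mul_div_spread_eight M hfree hns hd hn (by norm_num) hK
  norm_num at h
  exact h

end S1

end PercRepro
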